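import Summits.RiemannHypothesis.RiemannHypothesis.Theorems.MotivicDoor.AWS.PrimeSideLattice
import Summits.RiemannHypothesis.RiemannHypothesis.Theorems.MotivicDoorDiagonalDivergence
import Summits.RiemannHypothesis.RiemannHypothesis.Theorems.MotivicDoorAWSDisjointBumps

/-!
# Arithmetic Weil surfaces: the lattice of any carrier has infinite rank (AWS sprint, cc-3 gen 6)

An RH-FREE structural theorem about the axiom system `ArithmeticWeilSurface` of
`Theorems.MotivicDoorAWSStructure` (p195737), upgrading the DERIVED remark of `AXIOM-CONTENT.md` §2
("`L` can never be a finitely generated Néron–Severi-type lattice") to a kernel-checked theorem.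

## Results

* `GeneratingFamily.exists_weilQuadratic_posDef` (RH-free, non-vacuous — generating families
  exist unconditionally, `nonempty_generatingFamily`, p197005): for every generating family `G` and
  every `n`, there are `n` INTEGER combinations `u_{c_1}, …, u_{c_n}` of the generators on whose real
  span Weil's quadratic functional is POSITIVE DEFINITE:
  `Re W((Σ y_j u_{c_j}) ⋆ (Σ y_j u_{c_j})~) > 0` for all real `y ≠ 0`.
  Proof: Yoshida's small-window positivity in the quantitative form PROVED in the tree
  (`exists_log_window_lower_bound`: `Re Q(g) ≥ (log(1/a) − K)‖g‖₂²` on `[-a, a]`) makes `Re Q`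
  positive definite on `n` disjointly supported bumps in a small window (part 1,
  `Theorems.MotivicDoorAWSDisjointBumps`); the density axiom of `G`
  moves this to rational multiples of integer combinations, by the `C¹`-sup continuity of `Q` on a
  fixed window (`norm_weilQuadratic_sub_le`, pair continuity `stub_pairContinuity`) and the Gram
  expansion `re_weilQuadratic_sum_real`.
* `ArithmeticWeilSurface.exists_weilForm_negDef`: on every arithmetic Weil surface `X` and for every
  `n` there are Frobenius-type cycles `D_1, …, D_n ∈ L` (cycles of integer combinations of the
  generators) such that the Weil form `D·D − 2 (D·e₁)(D·e₂)` (the self-intersection of the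
  projection of `D` to `⟨e₁, e₂⟩^⊥`) is NEGATIVE DEFINITE on their integer span
  (`weilForm_eq_of_arithmeticWeilSurface`: it equals `−Re Q`).
* `ArithmeticWeilSurface.exists_linearIndependent_cycles`, `ArithmeticWeilSurface.not_moduleFinite`,
  `ArithmeticWeilSurface.aleph0_le_rank`: consequently these cycles are `ℤ`-linearly independent,
  `L` is NOT a finitely generated abelian group, and `rank_ℤ L ≥ ℵ₀`.

## Honest label

Nothing here asserts that an arithmetic Weil surface exists (`Nonempty ArithmeticWeilSurface ↔ RH`,
`nonempty_arithmeticWeilSurface_iff_riemannHypothesis`, p197702; its non-vacuity is RH itself and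
is not claimed).  The theorems are constraints every carrier must satisfy: no finite-level /
finite-rank lattice (in particular no Néron–Severi lattice of an actual surface over a finite
field, which is finitely generated) can carry the prime-side axioms — the "curve `Spec ℤ ⊗ Spec ℤ`"
would have to have infinite-dimensional `H²`.  The generating-family statement is unconditional
and non-vacuous.
-/

noncomputable section

open Complex Set MeasureTheory Filter Literature.NumberTheory.LFunctions
open Literature.NumberTheory.ConnesConsani2019
open Summit.RiemannHypothesis.RiemannHypothesis.Theorems.MotivicDoor.ConnesConsani
open Summit.RiemannHypothesis.RiemannHypothesis.Theorems.PfPersistence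
  (weilCross reGram re_weilQuadratic_sum_real)
open scoped BigOperators ComplexConjugate

namespace Summit.RiemannHypothesis.RiemannHypothesis.Theorems.MotivicDoor.AWS

-- the mandated namespace repeats a component (single-conjunct summit)
set_option linter.dupNamespace false

/-! ## §1 Positive definiteness of `Re Q` on integer combinations of a generating family -/

namespace GeneratingFamily

variable (G : GeneratingFamily)

/-- `u_c(t)` as a `ℤ`-linear combination of the values `φ_i(t)`. -/
theorem testCombination_eq_linearCombination {ι : Type*} (φ : ι → ℝ → ℝ) (c : ι →₀ ℤ) (t : ℝ) :
    testCombination φ c t = Finsupp.linearCombination ℤ (fun i ↦ φ i t) c := by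
  simp only [testCombination, Finsupp.linearCombination_apply, zsmul_eq_mul]

/-- `u_{Σ m_j c_j} = Σ m_j u_{c_j}`. -/
theorem testCombination_sum_zsmul {ι : Type*} (φ : ι → ℝ → ℝ) {n : ℕ} (m : Fin n → ℤ)
    (c : Fin n → (ι →₀ ℤ)) (t : ℝ) :
    testCombination φ (∑ j, m j • c j) t = ∑ j, (m j : ℝ) * testCombination φ (c j) t := by
  simp only [testCombination_eq_linearCombination, map_sum, map_zsmul, zsmul_eq_mul]

/-- `g_{Σ m_j c_j} = Σ m_j g_{c_j}` (complexified). -/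
theorem ctest_sum_zsmul {n : ℕ} (m : Fin n → ℤ) (c : Fin n → (G.ι →₀ ℤ)) (t : ℝ) :
    G.ctest (∑ j, m j • c j) t = ∑ j, ((m j : ℝ) : ℂ) * G.ctest (c j) t := by
  simp [ctest, testCombination_sum_zsmul, Complex.ofReal_sum, Complex.ofReal_mul]

/-- **`Re Q` is positive definite on suitable rank-`n` integer sublattices of the span of any
generating family** (RH-free).  For every `n` there are integer combinations `u_{c_1}, …, u_{c_n}`
of the generators with `Re W(U ⋆ Ũ) > 0` for every non-zero REAL combination `U = Σ y_j u_{c_j}`.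
(Small-window positivity `exists_log_window_lower_bound` on `n` disjoint bumps, transported to the
family by the density axiom and the `C¹`-sup continuity of `Q` on a window,
`norm_weilQuadratic_sub_le`.) -/
theorem exists_weilQuadratic_posDef (n : ℕ) :
    ∃ c : Fin n → (G.ι →₀ ℤ), ∀ y : Fin n → ℝ, y ≠ 0 →
      0 < (weilQuadratic fun t ↦ ∑ j, (y j : ℂ) * G.ctest (c j) t).re := by
  classical
  /- 1. a window `[-a, a]` on which `Re Q(g) ≥ ‖g‖₂²` -/
  obtain ⟨K, a₀, ha₀, -, hwin⟩ := exists_log_window_lower_bound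
  obtain ⟨a, ha, haa₀, hloga⟩ : ∃ a : ℝ, 0 < a ∧ a ≤ a₀ ∧ 1 ≤ Real.log (1 / a) - K := by
    refine ⟨min a₀ (Real.exp (-(K + 1))), lt_min ha₀ (Real.exp_pos _), min_le_left _ _, ?_⟩
    have h1 : Real.log (min a₀ (Real.exp (-(K + 1)))) ≤ -(K + 1) := by
      have := Real.log_le_log (lt_min ha₀ (Real.exp_pos _))
        (min_le_right a₀ (Real.exp (-(K + 1))))
      rwa [Real.log_exp] at this
    rw [one_div, Real.log_inv]
    linarith
  have hwin1 : ∀ g : ℝ → ℂ, IsWeilTest g → tsupport g ⊆ Icc (-a) a → 0 < ∫ t, ‖g t‖ ^ 2 →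
      ∫ t, ‖g t‖ ^ 2 ≤ (weilQuadratic g).re := fun g hg hs hp ↦
    (le_mul_of_one_le_left hp.le hloga).trans (hwin a ha haa₀ g hg hs hp)
  /- 2. `n` separated bumps `β_j` in the window and their derivative bound -/
  obtain ⟨β, r, Sb, hr, hSb0, hW, hβsupp, hβle, hβdisj, hβint, hβL2, hSb⟩ :=
    exists_disjoint_bumps ha n
  /- 3. the windows of the density axiom, the pair-continuity constant, the tolerance -/
  choose R hR0 hRsupp hdense using fun j ↦ G.dense (β j) (hW j)
  have hsumR : 0 ≤ ∑ j, R j := Finset.sum_nonneg fun j _ ↦ (hR0 j).le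
  have hRj : ∀ j, R j ≤ a + ∑ k, R k := fun j ↦ by
    have := Finset.single_le_sum (fun k (_ : k ∈ Finset.univ) ↦ (hR0 k).le) (Finset.mem_univ j)
    linarith
  have hRm : 0 < a + ∑ j, R j := by linarith
  obtain ⟨C, hC0, hC⟩ := Theorems.stub_pairContinuity (a + ∑ j, R j) hRm
  have hKQ0 : 0 ≤ C * (2 * (a + ∑ j, R j)) * (6 + 3 * (n : ℝ) + (n : ℝ) * Sb) := by positivity
  obtain ⟨ε, hε, hnε1, hnεK⟩ : ∃ ε : ℝ, 0 < ε ∧ (n : ℝ) * ε ≤ 1 ∧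
      (n : ℝ) * ε * (C * (2 * (a + ∑ j, R j)) * (6 + 3 * (n : ℝ) + (n : ℝ) * Sb)) ≤
        r / 2 := by
    set KQ : ℝ := C * (2 * (a + ∑ j, R j)) * (6 + 3 * (n : ℝ) + (n : ℝ) * Sb) with hKQ
    refine ⟨min (1 / ((n : ℝ) + 1)) (r / (2 * ((n : ℝ) + 1) * (KQ + 1))),
      lt_min (by positivity) (by positivity), ?_, ?_⟩
    · calc (n : ℝ) * min (1 / ((n : ℝ) + 1)) (r / (2 * ((n : ℝ) + 1) * (KQ + 1)))
          ≤ (n : ℝ) * (1 / ((n : ℝ) + 1)) :=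
            mul_le_mul_of_nonneg_left (min_le_left _ _) (Nat.cast_nonneg n)
        _ ≤ 1 := by rw [mul_one_div, div_le_one (by positivity)]; linarith
    · have hD : 0 < 2 * ((n : ℝ) + 1) * (KQ + 1) := by positivity
      calc (n : ℝ) * min (1 / ((n : ℝ) + 1)) (r / (2 * ((n : ℝ) + 1) * (KQ + 1))) * KQ
          ≤ (n : ℝ) * (r / (2 * ((n : ℝ) + 1) * (KQ + 1))) * KQ :=
            mul_le_mul_of_nonneg_right
              (mul_le_mul_of_nonneg_left (min_le_right _ _) (Nat.cast_nonneg n)) hKQ0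
        _ = (n : ℝ) * r * KQ / (2 * ((n : ℝ) + 1) * (KQ + 1)) := by ring
        _ ≤ r / 2 := by
            rw [div_le_iff₀ hD]
            have h1 : r / 2 * (2 * ((n : ℝ) + 1) * (KQ + 1)) - (n : ℝ) * r * KQ =
                r * ((n : ℝ) + KQ + 1) := by ring
            have h2 : 0 ≤ r * ((n : ℝ) + KQ + 1) := by positivity
            linarith
  /- 4. the approximants `s_j = N_j⁻¹ u_{c_j}` -/
  choose N c hN hcsupp hval hder using fun j ↦ hdense j ε hε
  refine ⟨c, ?_⟩
  set s : Fin n → ℝ → ℝ := fun j t ↦ ((N j : ℕ) : ℝ)⁻¹ * testCombination G.φ (c j) t with hs_def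
  have hval' : ∀ j t, |β j t - s j t| ≤ ε := hval
  have hder' : ∀ j t, |deriv (β j) t - deriv (s j) t| ≤ ε := hder
  have hS : ∀ j, IsWeilTest fun t ↦ ((s j t : ℝ) : ℂ) := fun j ↦ by
    have h := (G.isWeilTest_ctest (c j)).const_mul ((((N j : ℕ) : ℝ)⁻¹ : ℝ) : ℂ)
    convert h using 1
    funext t
    simp [hs_def, ctest, Complex.ofReal_mul]
  have hs_zero : ∀ j, ∀ t ∉ Icc (-(a + ∑ k, R k)) (a + ∑ k, R k), s j t = 0 := fun j t ht ↦ by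
    have h1 : t ∉ tsupport (testCombination G.φ (c j)) := fun h ↦
      ht (Icc_subset_Icc (by linarith [hRj j]) (hRj j) (hcsupp j h))
    simp [hs_def, image_eq_zero_of_notMem_tsupport h1]
  /- 5. `Re Q ≥ r/2` on the unit sphere of the span of the approximants -/
  have key : ∀ z : Fin n → ℝ, ∑ j, z j ^ 2 = 1 →
      r / 2 ≤ (weilQuadratic fun t ↦ ∑ j, (z j : ℂ) * ((s j t : ℝ) : ℂ)).re := by
    intro z hz
    have hzj : ∀ j, |z j| ≤ 1 := fun j ↦ by
      rw [← sq_le_one_iff_abs_le_one]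
      calc z j ^ 2 ≤ ∑ k, z k ^ 2 :=
            Finset.single_le_sum (fun k _ ↦ sq_nonneg (z k)) (Finset.mem_univ j)
        _ = 1 := hz
    have hzsum : ∑ j, |z j| ≤ n := by
      calc ∑ j, |z j| ≤ ∑ _j : Fin n, (1 : ℝ) := Finset.sum_le_sum fun j _ ↦ hzj j
        _ = n := by simp
    have hzsum0 : 0 ≤ ∑ j, |z j| := Finset.sum_nonneg fun j _ ↦ abs_nonneg _
    -- the exact window combination `U = Σ z_j β_j` and its approximant `V = Σ z_j s_j`
    have hU : IsWeilTest fun t ↦ ∑ j, (z j : ℂ) * ((β j t : ℝ) : ℂ) :=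
      isWeilTest_finset_sum Finset.univ fun j _ ↦ (hW j).const_mul (z j : ℂ)
    have hV : IsWeilTest fun t ↦ ∑ j, (z j : ℂ) * ((s j t : ℝ) : ℂ) :=
      isWeilTest_finset_sum Finset.univ fun j _ ↦ (hS j).const_mul (z j : ℂ)
    have hsU : tsupport (fun t ↦ ∑ j, (z j : ℂ) * ((β j t : ℝ) : ℂ)) ⊆
        Icc (-(a + ∑ k, R k)) (a + ∑ k, R k) :=
      (DisjointFamily.tsupport_sum_subset isClosed_Icc hβsupp z).trans
        (Icc_subset_Icc (by linarith) (by linarith))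
    have hsV : tsupport (fun t ↦ ∑ j, (z j : ℂ) * ((s j t : ℝ) : ℂ)) ⊆
        Icc (-(a + ∑ k, R k)) (a + ∑ k, R k) := by
      refine closure_minimal (fun t ht ↦ ?_) isClosed_Icc
      by_contra hta
      exact ht (Finset.sum_eq_zero fun j _ ↦ by rw [hs_zero j t hta]; simp)
    -- sup bounds of `U`, `U'`
    have hUS : ∀ t, ‖∑ j, (z j : ℂ) * ((β j t : ℝ) : ℂ)‖ ≤ n := fun t ↦
      (norm_sum_ofReal_mul_le z (fun j ↦ β j t) (fun j ↦ hβle j t)).trans (by rw [mul_one]; exact hzsum)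
    have hdW : ∀ j, deriv (fun t ↦ ((β j t : ℝ) : ℂ)) = fun t ↦ ((deriv (β j) t : ℝ) : ℂ) :=
      fun j ↦ deriv_ofReal_comp_of_isWeilTest (hW j)
    have hdS : ∀ j, deriv (fun t ↦ ((s j t : ℝ) : ℂ)) = fun t ↦ ((deriv (s j) t : ℝ) : ℂ) :=
      fun j ↦ deriv_ofReal_comp_of_isWeilTest (hS j)
    have hUS' : ∀ t, ‖deriv (fun t ↦ ∑ j, (z j : ℂ) * ((β j t : ℝ) : ℂ)) t‖ ≤ n * Sb := fun t ↦ by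
      rw [deriv_sum_mul_apply hW (fun j ↦ (z j : ℂ)) t]
      simp only [hdW]
      exact (norm_sum_ofReal_mul_le z _ (fun j ↦ hSb j t)).trans
        (mul_le_mul_of_nonneg_right hzsum hSb0)
    -- `U − V`, `U' − V'`
    have hUV : ∀ t, ‖∑ j, (z j : ℂ) * ((β j t : ℝ) : ℂ) - ∑ j, (z j : ℂ) * ((s j t : ℝ) : ℂ)‖ ≤
        n * ε := fun t ↦ by
      rw [← Finset.sum_sub_distrib]
      simp_rw [← mul_sub, ← Complex.ofReal_sub]
      exact (norm_sum_ofReal_mul_le z _ (fun j ↦ hval' j t)).trans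
        (mul_le_mul_of_nonneg_right hzsum hε.le)
    have hUV' : ∀ t, ‖deriv (fun t ↦ ∑ j, (z j : ℂ) * ((β j t : ℝ) : ℂ)) t -
        deriv (fun t ↦ ∑ j, (z j : ℂ) * ((s j t : ℝ) : ℂ)) t‖ ≤ n * ε := fun t ↦ by
      rw [deriv_sum_mul_apply hW (fun j ↦ (z j : ℂ)) t, deriv_sum_mul_apply hS (fun j ↦ (z j : ℂ)) t,
        ← Finset.sum_sub_distrib]
      simp only [hdW, hdS]
      simp_rw [← mul_sub, ← Complex.ofReal_sub]
      exact (norm_sum_ofReal_mul_le z _ (fun j ↦ hder' j t)).trans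
        (mul_le_mul_of_nonneg_right hzsum hε.le)
    -- continuity of `Q` on the window
    have hQ := norm_weilQuadratic_sub_le hRm hC0 hC hU hV hsU hsV (by positivity) hnε1 hUS hUS'
      hUV hUV'
    have hQre : (weilQuadratic fun t ↦ ∑ j, (z j : ℂ) * ((β j t : ℝ) : ℂ)).re -
        (weilQuadratic fun t ↦ ∑ j, (z j : ℂ) * ((s j t : ℝ) : ℂ)).re ≤ r / 2 := by
      rw [← Complex.sub_re]
      exact ((le_abs_self _).trans (Complex.abs_re_le_norm _)).trans (hQ.trans hnεK)
    -- the window law for `U`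
    have hL2 := DisjointFamily.mul_sum_sq_le_integral_norm_sq hβdisj hβint hβL2 z
    rw [hz, mul_one] at hL2
    have hUwin := hwin1 _ hU (DisjointFamily.tsupport_sum_subset isClosed_Icc hβsupp z)
      (hr.trans_le hL2)
    linarith
  /- 6. homogeneity: `Re Q > 0` on the whole span of the approximants minus `0` -/
  have key' : ∀ z : Fin n → ℝ, z ≠ 0 →
      0 < (weilQuadratic fun t ↦ ∑ j, (z j : ℂ) * ((s j t : ℝ) : ℂ)).re := by
    intro z hz
    have hpos : 0 < ∑ j, z j ^ 2 := by
      obtain ⟨j, hj⟩ := Function.ne_iff.mp hz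
      have hj' : z j ≠ 0 := hj
      exact lt_of_lt_of_le (sq_pos_iff.mpr hj')
        (Finset.single_le_sum (fun k _ ↦ sq_nonneg (z k)) (Finset.mem_univ j))
    obtain ⟨ν, hν, hν2⟩ : ∃ ν : ℝ, 0 < ν ∧ ν ^ 2 = ∑ j, z j ^ 2 :=
      ⟨Real.sqrt (∑ j, z j ^ 2), Real.sqrt_pos.2 hpos, Real.sq_sqrt hpos.le⟩
    have hform : ∀ w : Fin n → ℝ, (weilQuadratic fun t ↦ ∑ j, (w j : ℂ) * ((s j t : ℝ) : ℂ)).re =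
        dotProduct w (Matrix.mulVec (reGram (fun j t ↦ ((s j t : ℝ) : ℂ))) w) := fun w ↦
      re_weilQuadratic_sum_real hS w
    have hz' : ∑ j, (ν⁻¹ * z j) ^ 2 = 1 := by
      simp_rw [mul_pow]
      rw [← Finset.mul_sum, ← hν2, inv_pow, inv_mul_cancel₀ (pow_ne_zero 2 hν.ne')]
    have hzz : z = ν • fun j ↦ ν⁻¹ * z j := by
      funext j; simp [mul_inv_cancel_left₀ hν.ne']
    have hscale : (weilQuadratic fun t ↦ ∑ j, (z j : ℂ) * ((s j t : ℝ) : ℂ)).re =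
        ν ^ 2 * (weilQuadratic fun t ↦ ∑ j, ((ν⁻¹ * z j : ℝ) : ℂ) * ((s j t : ℝ) : ℂ)).re := by
      rw [hform z, hform (fun j ↦ ν⁻¹ * z j)]
      conv_lhs => rw [hzz]
      rw [Matrix.mulVec_smul, dotProduct_smul, smul_dotProduct, smul_eq_mul, smul_eq_mul]
      ring
    rw [hscale]
    exact mul_pos (by positivity) (lt_of_lt_of_le (by positivity) (key _ hz'))
  /- 7. back to the integer combinations `u_{c_j} = N_j s_j` -/
  intro y hy
  have hfun : (fun t ↦ ∑ j, (y j : ℂ) * G.ctest (c j) t) =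
      fun t ↦ ∑ j, ((y j * N j : ℝ) : ℂ) * ((s j t : ℝ) : ℂ) := by
    funext t
    refine Finset.sum_congr rfl fun j _ ↦ ?_
    have hNj : ((N j : ℕ) : ℂ) ≠ 0 := Nat.cast_ne_zero.2 (hN j).ne'
    simp only [hs_def, ctest]
    push_cast
    field_simp
  rw [hfun]
  refine key' (fun j ↦ y j * N j) fun h0 ↦ hy ?_
  funext j
  have h := congrFun h0 j
  have hNj : ((N j : ℕ) : ℝ) ≠ 0 := Nat.cast_ne_zero.2 (hN j).ne'
  simpa [hNj] using h

end GeneratingFamily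

/-! ## §2 Consequences for arithmetic Weil surfaces: negative-definite Frobenius sublattices of
every rank; the lattice is not finitely generated -/

namespace ArithmeticWeilSurface

variable (X : ArithmeticWeilSurface)

/-- The cycle map is the `ℤ`-linear extension of `frob`. -/
theorem cycle_eq_linearCombination (c : X.gen.ι →₀ ℤ) :
    X.cycle c = Finsupp.linearCombination ℤ X.frob c := by
  simp only [ArithmeticWeilSurface.cycle, Finsupp.linearCombination_apply]

/-- `D(u_{Σ m_j c_j}) = Σ m_j D(u_{c_j})`. -/
theorem cycle_sum_zsmul {n : ℕ} (m : Fin n → ℤ) (c : Fin n → (X.gen.ι →₀ ℤ)) :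
    X.cycle (∑ j, m j • c j) = ∑ j, m j • X.cycle (c j) := by
  simp only [cycle_eq_linearCombination, map_sum, map_zsmul]

/-- The complexified test function of `Σ m_j c_j` is the real combination `Σ m_j g_{c_j}`. -/
theorem ofReal_test_sum_zsmul {n : ℕ} (m : Fin n → ℤ) (c : Fin n → (X.gen.ι →₀ ℤ)) :
    (fun t ↦ (X.test (∑ j, m j • c j) t : ℂ)) =
      fun t ↦ ∑ j, (((m j : ℤ) : ℝ) : ℂ) * X.gen.ctest (c j) t := by
  funext t
  exact X.gen.ctest_sum_zsmul m c t

/-- **Negative-definite Frobenius sublattices of every rank.**  On every arithmetic Weil surface and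
for every `n` there are cycles `D_j = D(u_{c_j})` of integer combinations of the generators such
that the Weil form `D·D − 2 (D·e₁)(D·e₂)` is NEGATIVE DEFINITE on their integer span:
for every `m ∈ ℤⁿ ∖ {0}` and `D = Σ m_j D_j`, `D·D − 2 (D·e₁)(D·e₂) < 0`. -/
theorem exists_weilForm_negDef (n : ℕ) :
    ∃ c : Fin n → (X.gen.ι →₀ ℤ), ∀ m : Fin n → ℤ, m ≠ 0 →
      X.inter (X.cycle (∑ j, m j • c j)) (X.cycle (∑ j, m j • c j)) -
          2 * (X.inter (X.cycle (∑ j, m j • c j)) X.e₁ *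
            X.inter (X.cycle (∑ j, m j • c j)) X.e₂) < 0 := by
  obtain ⟨c, hc⟩ := X.gen.exists_weilQuadratic_posDef n
  refine ⟨c, fun m hm ↦ ?_⟩
  rw [weilForm_eq_of_arithmeticWeilSurface, neg_lt_zero, ofReal_test_sum_zsmul]
  refine hc (fun j ↦ (m j : ℝ)) fun h0 ↦ hm ?_
  funext j
  simpa using congrFun h0 j

/-- **Linearly independent Frobenius cycles of every finite rank**, spanning a negative-definite
sublattice for the Weil form. -/
theorem exists_linearIndependent_cycles (n : ℕ) :
    ∃ c : Fin n → (X.gen.ι →₀ ℤ), LinearIndependent ℤ (fun j ↦ X.cycle (c j)) ∧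
      ∀ m : Fin n → ℤ, m ≠ 0 →
        X.inter (X.cycle (∑ j, m j • c j)) (X.cycle (∑ j, m j • c j)) -
            2 * (X.inter (X.cycle (∑ j, m j • c j)) X.e₁ *
              X.inter (X.cycle (∑ j, m j • c j)) X.e₂) < 0 := by
  obtain ⟨c, hc⟩ := X.exists_weilForm_negDef n
  refine ⟨c, ?_, hc⟩
  rw [Fintype.linearIndependent_iff]
  intro m hm0
  by_contra hne
  obtain ⟨i, hi⟩ := not_forall.mp hne
  have hm : m ≠ 0 := fun h ↦ hi (congrFun h i)
  have h := hc m hm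
  rw [cycle_sum_zsmul, hm0] at h
  simp at h

/-- **The lattice of an arithmetic Weil surface is not finitely generated** (as an abelian group /
`ℤ`-module): it contains `ℤ`-linearly independent families of every finite size. -/
theorem not_moduleFinite : ¬ Module.Finite ℤ X.L := by
  intro hfin
  haveI := hfin
  obtain ⟨c, hli, -⟩ := X.exists_linearIndependent_cycles (Module.finrank ℤ X.L + 1)
  have h := hli.fintype_card_le_finrank
  simp at h

/-- **The lattice of an arithmetic Weil surface has infinite rank**: `ℵ₀ ≤ rank_ℤ L`. -/
theorem aleph0_le_rank : Cardinal.aleph0 ≤ Module.rank ℤ X.L := by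
  rw [Cardinal.aleph0_le]
  intro n
  obtain ⟨c, hli, -⟩ := X.exists_linearIndependent_cycles n
  simpa using hli.cardinal_le_rank

end ArithmeticWeilSurface

end Summit.RiemannHypothesis.RiemannHypothesis.Theorems.MotivicDoor.AWS
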